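import Mathlib
import Summits.Ventures.PercRepro2.HCov
import Summits.Ventures.PercRepro2.RootLeafUHalf
import Summits.Ventures.PercRepro2.RootLeafUOu
import Summits.Ventures.PercRepro2.RootLeafUClaimI
import Summits.Ventures.PercRepro2.RootLeafULSideHalfII

/-!
# `(m2) = (II) + (I′)`: the four-mark claim of the `L` side reduces to its `b ∈ K` half (blind cell PercRepro2,
p4 g30; S3 (G4-u) item (ap), proofs/P4-G30-HALVES.md §1–§3)

With the vocabulary of RootLeafULSidePD / RootLeafULSideHalfII (`u = a₁`, `c = a₃`, `Q = {a₂ ↮ u}`, `Z = P(Q)`,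
`PD, T, T′` with masses `D, t, t′`, `W = D + t`, `W′ = D + t′`, `hb = P(a₂ ↔ b)`, `d0 = P(a₂ ↮ c)`, `β = D + d0·Z`):

* **`m2_eq_halfII_add_halfIp`**: the four-mark claim `(m2)` of `LSidePD.T2oL_nonneg_of_m2_K5L` equals
  `(II) + (I′)` EXACTLY, where `(II) = 2·D·W·[(1 − d0)·P(Q,bL) − P(T,bL)] − β·Γ` (RootLeafULSideHalfII, a THEOREM),
  `(I′) := 2·D·W′·(W·hb − P(R,bK)) + 2·D·(1 − d0)·(t′·P(R,bK) − W·P(T′,bK)) − β·Γ` and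
  `Γ = t·P(PD,bL) − D·P(T,bL)` (a `ring` identity after `Qsplit`, `Qsplit_univ`, `gap_eq_Q`);
* **`m2_nonneg_of_halfIp`**: `0 ≤ (I′) → 0 ≤ (m2)` (`halfII` pays the other half);
* the `o ∈ L` half of W1 on the `K5_L`-class MODULO `(I′)` (`T2oL_nonneg_of_Ip_K5L`, the same conditional shape as
  `LSidePD.T2oL_nonneg_of_m2_K5L` with the hypothesis weakened from `(m2)` to its `b ∈ K` half) is the one-line corollary
  in RootLeafULSideHalvesT2.lean (kept apart: it imports RootLeafULSidePD).
-/

namespace Summit.Ventures.PercRepro2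

open UnionCluster CovForm

namespace RootLeafU

namespace LSideII

variable {V : Type*} {E : Type*} [Fintype E] [DecidableEq E] [Fintype V] [DecidableEq V]
  {R : Type*} [Field R] [LinearOrder R] [IsStrictOrderedRing R]

variable (p : E → R) (ends : E → Sym2 V) (a₂ c b u : V)

omit [Fintype V] in
/-- **`(m2) = (II) + (I′)`** (a `ring` identity in the split masses). -/
theorem m2_eq_halfII_add_halfIp :
    prob p (PDEvent ends u a₂ c) * ((prob p (PDEvent ends u a₂ c) * prob p (connEvent ends a₂ b) + prob p (avoidAll ends a₂ {c}) * gap p ends u a₂ b) + (prob p Set.univ * EQb3 p ends u a₂ c b + prob p Set.univ * PDb p ends u a₂ c b + prob p (connEvent ends a₂ b) * EQ3 p ends u a₂ c + prob p (connEvent ends a₂ b) * prob p (avoidAll ends a₂ {u}) - (prob p Set.univ - prob p (avoidAll ends a₂ {c})) * gap p ends u a₂ b)) * (prob p (PDEvent ends u a₂ c) + prob p (TEvent ends u a₂ c)) + 2 * (prob p Set.univ * prob p (PDEvent ends u a₂ c) + prob p (avoidAll ends a₂ {c}) * prob p (avoidAll ends a₂ {u})) * prob p (PDEvent ends u a₂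 c) * (prob p (TEvent ends u a₂ c ∩ connEvent ends u b) - (prob p (PDEvent ends u a₂ c ∩ connEvent ends a₂ b) + prob p (TEvent ends u a₂ c ∩ connEvent ends a₂ b))) - 2 * (prob p Set.univ * prob p (PDEvent ends u a₂ c) + prob p (avoidAll ends a₂ {c}) * prob p (avoidAll ends a₂ {u})) * prob p (TEvent ends u a₂ c) * prob p (PDEvent ends u a₂ c ∩ connEvent ends u b) =
      (2 * prob p (PDEvent ends u a₂ c) * (prob p (PDEvent ends u a₂ c) + prob p (TEvent ends u a₂ c)) * ((1 - prob p (avoidAll ends a₂ {c})) * (prob p (PDEvent ends u a₂ c ∩ connEvent ends u b) + prob p (TEvent ends u a₂ c ∩ connEvent ends u b) + prob p (TEvent ends a₂ u c ∩ connEvent ends u b)) - prob p (TEvent ends u a₂ c ∩ connEvent ends u b)) - (prob p (PDEvent ends u a₂ c) + prob p (avoidAll ends a₂ {c}) * prob p (avoidAll ends a₂ {u})) * (prob p (TEvent ends u a₂ c) * prob p (PDEvent ends u a₂ c ∩ connEvent ends u b) - prob p (PDEvent ends u a₂ c) * prob p (TEvent ends u a₂ c ∩ connEvent ends u b)))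
      + (2 * prob p (PDEvent ends u a₂ c) * (prob p (PDEvent ends u a₂ c) + prob p (TEvent ends a₂ u c)) * ((prob p (PDEvent ends u a₂ c) + prob p (TEvent ends u a₂ c)) * prob p (connEvent ends a₂ b) - (prob p (PDEvent ends u a₂ c ∩ connEvent ends a₂ b) + prob p (TEvent ends u a₂ c ∩ connEvent ends a₂ b))) + 2 * prob p (PDEvent ends u a₂ c) * (1 - prob p (avoidAll ends a₂ {c})) * (prob p (TEvent ends a₂ u c) * (prob p (PDEvent ends u a₂ c ∩ connEvent ends a₂ b) + prob p (TEvent ends u a₂ c ∩ connEvent ends a₂ b)) - (prob p (PDEvent ends u a₂ c) + prob p (TEvent ends u a₂ c)) * prob p (TEvent ends a₂ u c ∩ connEvent ends a₂ b)) - (prob p (PDEvent ends u a₂ c) + prob p (avoidAll ends a₂ {c}) * prob p (avoidAll ends a₂ {u})) * (prob p (TEvent ends u a₂ c) * prob p (PDEvent ends u a₂ c ∩ connEvent ends u b) - prob p (PDEvent ends u a₂ c) * prob p (TEvent ends u a₂ c ∩ connEvent ends u b))) := by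
  have hZ := Qsplit_univ p ends u a₂ c
  have hbK := Qsplit p ends u a₂ c (connEvent ends a₂ b)
  have hbL := Qsplit p ends u a₂ c (connEvent ends u b)
  have hgap := gap_eq_Q p ends u a₂ b
  unfold EQb3 PDb EQ3
  rw [hgap, hZ, hbK, hbL, prob_univ]
  ring

/-- **`0 ≤ (I′) → 0 ≤ (m2)`**: the `b ∈ L` half is the theorem `halfII`; the four-mark claim holds wherever its
`b ∈ K` half `(I′)` does. -/
theorem m2_nonneg_of_halfIp (hp : IsProbVec p)
    (hIp : 0 ≤ 2 * prob p (PDEvent ends u a₂ c) * (prob p (PDEvent ends u a₂ c) + prob p (TEvent ends a₂ u c)) * ((prob p (PDEvent ends u a₂ c) + prob p (TEvent ends u a₂ c)) * prob p (connEvent ends a₂ b) - (prob p (PDEvent ends u a₂ c ∩ connEvent ends a₂ b) + prob p (TEvent ends u a₂ c ∩ connEvent ends a₂ b))) + 2 * prob p (PDEvent ends u a₂ c) * (1 - prob p (avoidAll ends a₂ {c})) * (prob p (TEvent ends a₂ u c) * (prob p (PDEvent ends u a₂ c ∩ connEvent ends a₂ b) + prob p (TEvent ends u a₂ c ∩ connEvent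 ends a₂ b)) - (prob p (PDEvent ends u a₂ c) + prob p (TEvent ends u a₂ c)) * prob p (TEvent ends a₂ u c ∩ connEvent ends a₂ b)) - (prob p (PDEvent ends u a₂ c) + prob p (avoidAll ends a₂ {c}) * prob p (avoidAll ends a₂ {u})) * (prob p (TEvent ends u a₂ c) * prob p (PDEvent ends u a₂ c ∩ connEvent ends u b) - prob p (PDEvent ends u a₂ c) * prob p (TEvent ends u a₂ c ∩ connEvent ends u b))) :
    0 ≤ prob p (PDEvent ends u a₂ c) * ((prob p (PDEvent ends u a₂ c) * prob p (connEvent ends a₂ b) + prob p (avoidAll ends a₂ {c}) * gap p ends u a₂ b) + (prob p Set.univ * EQb3 p ends u a₂ c b + prob p Set.univ * PDb p ends u a₂ c b + prob p (connEvent ends a₂ b) * EQ3 p ends u a₂ c + prob p (connEvent ends a₂ b) * prob p (avoidAll ends a₂ {u}) - (prob p Set.univ - prob p (avoidAll ends a₂ {c})) * gap p ends u a₂ b)) * (prob p (PDEvent ends u a₂ c) + prob p (TEvent ends u a₂ c)) + 2 * (prob p Set.univ * prob p (PDEvent ends u a₂ c) + prob p (avoidAll ends a₂ {c}) * prob p (avoidAll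 ends a₂ {u})) * prob p (PDEvent ends u a₂ c) * (prob p (TEvent ends u a₂ c ∩ connEvent ends u b) - (prob p (PDEvent ends u a₂ c ∩ connEvent ends a₂ b) + prob p (TEvent ends u a₂ c ∩ connEvent ends a₂ b))) - 2 * (prob p Set.univ * prob p (PDEvent ends u a₂ c) + prob p (avoidAll ends a₂ {c}) * prob p (avoidAll ends a₂ {u})) * prob p (TEvent ends u a₂ c) * prob p (PDEvent ends u a₂ c ∩ connEvent ends u b) := by
  rw [m2_eq_halfII_add_halfIp]
  have hII := halfII p ends a₂ c b u hp
  linarith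

end LSideII

end RootLeafU

end Summit.Ventures.PercRepro2
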